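import Literature.MathematicalPhysics.QuantumLattice.LindhardEllipticClosedForm
import Literature.Analysis.SpecialFunctions.EllipticKLogBound
import Literature.Analysis.SpecialFunctions.EllipticKAGMEnclosure
import HarnessLib

/-!
# Van Hove and band-edge bounds for the density of states of the anisotropic square-lattice band

Topic `Literature/MathematicalPhysics/QuantumLattice`. The density-of-states mass of the band
`-2(a cos k₀ + b cos k₁)` at energy `μ` has the closed form `anisoDOSMass μ a b`
(`LindhardEllipticClosedForm.lean`, CERT-SREP (1.1) × (2π)²: `8K(16ab/P)/√P` for `|μ| < 2|a-b|`,
`2K(P/(16ab))/√(ab)` for `2|a-b| ≤ |μ| < 2(a+b)`, `0` beyond the band edge; `P = 4(a+b)² - μ²`,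
`K = ellipticK`, parameter convention). In both in-band regimes the complementary parameter is
`1 - m = x/P` resp. `x/(16ab)` with `x = |4(a-b)² - μ²|` the distance (in energy²) to the van Hove
level `|μ| = 2|a-b|`, so the two elementary majorants of `K`,

* `K(m) ≤ π/(2√(1-m))` (`Literature.Analysis.SpecialFunctions.ellipticK_le_pi_div_two_mul_sqrt`),
* `K(m) ≤ log(1/√(1-m)) + 2 log(1+√2)` (`Literature.Analysis.SpecialFunctions.ellipticK_le_log`),

give the two bounds by which a certified quadrature of `χ₀ = (2π)⁻² ∫₀¹ anisoDOSMass …` controls the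
cells meeting the van Hove logarithm and the band edge (CERT-SREP §2 (B1), (B2), gate-hubbard-kl):

* `anisoDOSMass_nonneg`;
* `anisoDOSMass_le_edge` — **(B1)** `anisoDOSMass μ a b ≤ 4π/√x` (i.e. `ρ ≤ 1/(π√x)`), off the van
  Hove level;
* `anisoDOSMass_le_log` — **(B2)** inside the band and off the van Hove level, for any
  `C ≥ max(16ab, P)`: `anisoDOSMass μ a b ≤ 2(2 log(1+√2) + ½ log(C/x))/√(ab)`
  (i.e. `ρ ≤ (c_K + ½ log(C/x))/(2π²√(ab))`, `c_K = 2 log(1+√2)`).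

## References
* [RaghuKivelsonScalapino2010] S. Raghu, S. A. Kivelson, D. J. Scalapino, Phys. Rev. B 81 (2010) 224505, §II (6)
  (the square-lattice DOS / Lindhard objects).
* [BorweinBorwein1987] J. M. Borwein, P. B. Borwein, *Pi and the AGM* (1987), Thm 1.1, §1.3 (the two `K` bounds).
* Cell note CERT-SREP §2 (gate-hubbard-kl, 2026), inequalities (B1)–(B2).
-/

noncomputable section

open Real _root_.Set
open Literature.Probability.RandomPlanarGeometry Literature.Analysis.SpecialFunctions

namespace Literature.MathematicalPhysics.QuantumLattice

variable {a b μ : ℝ}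

/-- The closed-form DOS mass is nonnegative (every branch is `c·K(·)/√(·)` with `K ≥ 0`, or `0`).
[cite: RaghuKivelsonScalapino2010, §II (6)] -/
theorem anisoDOSMass_nonneg (μ a b : ℝ) : 0 ≤ anisoDOSMass μ a b := by
  unfold anisoDOSMass
  split_ifs
  · exact div_nonneg (mul_nonneg (by norm_num) (ellipticK_nonneg _)) (Real.sqrt_nonneg _)
  · exact div_nonneg (mul_nonneg (by norm_num) (ellipticK_nonneg _)) (Real.sqrt_nonneg _)
  · exact le_rfl

/-- `|μ| < 2|c| ⟹ μ² < 4c²`. [folklore] -/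
private theorem sq_lt_four_mul_sq {μ c : ℝ} (h : |μ| < 2 * |c|) : μ ^ 2 < 4 * c ^ 2 := by
  have h2 : |μ| < |2 * c| := by rwa [abs_mul, abs_two]
  have := sq_lt_sq.2 h2
  nlinarith

/-- `2|c| < |μ| ⟹ 4c² < μ²`. [folklore] -/
private theorem four_mul_sq_lt_sq {μ c : ℝ} (h : 2 * |c| < |μ|) : 4 * c ^ 2 < μ ^ 2 := by
  have h2 : |2 * c| < |μ| := by rwa [abs_mul, abs_two]
  have := sq_lt_sq.2 h2
  nlinarith

/-- `√(16ab) = 4√(ab)`. [folklore] -/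
private theorem sqrt_sixteen_mul (a b : ℝ) : Real.sqrt (16 * a * b) = 4 * Real.sqrt (a * b) := by
  rw [show (16 : ℝ) * a * b = 4 ^ 2 * (a * b) by ring, Real.sqrt_mul (by norm_num),
    Real.sqrt_sq (by norm_num)]

/-- **(B1) — band-edge / van Hove bound.** For `a, b > 0` and `|μ| ≠ 2|a-b|`,
`anisoDOSMass μ a b ≤ 4π / √|4(a-b)² - μ²|`, i.e. `ρ(μ; a, b) ≤ 1/(π√x)` with `x = |V² - μ²|`,
`V = 2|a-b|` the van Hove energy (from `K(m) ≤ π/(2√(1-m))` and `1 - m = x/P`, resp. `x/(16ab)`).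
[cite: RaghuKivelsonScalapino2010, §II (6)] -/
theorem anisoDOSMass_le_edge (ha : 0 < a) (hb : 0 < b) (hμ : |μ| ≠ 2 * |a - b|) :
    anisoDOSMass μ a b ≤ 4 * Real.pi / Real.sqrt |4 * (a - b) ^ 2 - μ ^ 2| := by
  have hab : 0 < 16 * a * b := by positivity
  unfold anisoDOSMass
  by_cases hin : |μ| < 2 * |a - b|
  · -- inside the van Hove energy: `m = 16ab/P`, `1 - m = x/P`
    rw [if_pos hin]
    have hx : 0 < 4 * (a - b) ^ 2 - μ ^ 2 := by linarith [sq_lt_four_mul_sq hin]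
    rw [abs_of_pos hx]
    have hP : 0 < 4 * (a + b) ^ 2 - μ ^ 2 := by nlinarith
    have hPx : 4 * (a + b) ^ 2 - μ ^ 2 = 16 * a * b + (4 * (a - b) ^ 2 - μ ^ 2) := by ring
    have hm0 : 0 ≤ 16 * a * b / (4 * (a + b) ^ 2 - μ ^ 2) := div_nonneg hab.le hP.le
    have hm1 : 16 * a * b / (4 * (a + b) ^ 2 - μ ^ 2) < 1 := (div_lt_one hP).2 (by linarith)
    have h1m : 1 - 16 * a * b / (4 * (a + b) ^ 2 - μ ^ 2)
        = (4 * (a - b) ^ 2 - μ ^ 2) / (4 * (a + b) ^ 2 - μ ^ 2) := by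
      field_simp
      linarith
    have hK := ellipticK_le_pi_div_two_mul_sqrt hm0 hm1
    rw [h1m, Real.sqrt_div hx.le] at hK
    have hsP : 0 < Real.sqrt (4 * (a + b) ^ 2 - μ ^ 2) := Real.sqrt_pos.2 hP
    have hsx : 0 < Real.sqrt (4 * (a - b) ^ 2 - μ ^ 2) := Real.sqrt_pos.2 hx
    have hsPne := hsP.ne'
    have hsxne := hsx.ne'
    calc 8 * ellipticK (16 * a * b / (4 * (a + b) ^ 2 - μ ^ 2)) / Real.sqrt (4 * (a + b) ^ 2 - μ ^ 2)
        ≤ 8 * (Real.pi / (2 * (Real.sqrt (4 * (a - b) ^ 2 - μ ^ 2)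
            / Real.sqrt (4 * (a + b) ^ 2 - μ ^ 2)))) / Real.sqrt (4 * (a + b) ^ 2 - μ ^ 2) := by
          gcongr
      _ = 4 * Real.pi / Real.sqrt (4 * (a - b) ^ 2 - μ ^ 2) := by
          field_simp
          ring
  · rw [if_neg hin]
    have hgt : 2 * |a - b| < |μ| := lt_of_le_of_ne (not_lt.1 hin) (Ne.symm hμ)
    have hx : 0 < μ ^ 2 - 4 * (a - b) ^ 2 := by linarith [four_mul_sq_lt_sq hgt]
    rw [abs_of_neg (by linarith : 4 * (a - b) ^ 2 - μ ^ 2 < 0), neg_sub]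
    by_cases hout : |μ| < 2 * (a + b)
    · -- between the van Hove energy and the band edge: `m = P/(16ab)`, `1 - m = x/(16ab)`
      rw [if_pos hout]
      have hP : 0 < 4 * (a + b) ^ 2 - μ ^ 2 := by
        have h2 : |μ| < |2 * (a + b)| := by rwa [abs_of_pos (by positivity : (0:ℝ) < 2 * (a + b))]
        have := sq_lt_sq.2 h2
        nlinarith
      have hm0 : 0 ≤ (4 * (a + b) ^ 2 - μ ^ 2) / (16 * a * b) := div_nonneg hP.le hab.le
      have hm1 : (4 * (a + b) ^ 2 - μ ^ 2) / (16 * a * b) < 1 := (div_lt_one hab).2 (by nlinarith)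
      have h1m : 1 - (4 * (a + b) ^ 2 - μ ^ 2) / (16 * a * b) = (μ ^ 2 - 4 * (a - b) ^ 2) / (16 * a * b) := by
        field_simp
        ring
      have hK := ellipticK_le_pi_div_two_mul_sqrt hm0 hm1
      rw [h1m, Real.sqrt_div hx.le, sqrt_sixteen_mul] at hK
      have hsab : 0 < Real.sqrt (a * b) := Real.sqrt_pos.2 (by positivity)
      have hsx : 0 < Real.sqrt (μ ^ 2 - 4 * (a - b) ^ 2) := Real.sqrt_pos.2 hx
      have hsabne := hsab.ne'
      have hsxne := hsx.ne'
      calc 2 * ellipticK ((4 * (a + b) ^ 2 - μ ^ 2) / (16 * a * b)) / Real.sqrt (a * b)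
          ≤ 2 * (Real.pi / (2 * (Real.sqrt (μ ^ 2 - 4 * (a - b) ^ 2) / (4 * Real.sqrt (a * b)))))
              / Real.sqrt (a * b) := by gcongr
        _ = 4 * Real.pi / Real.sqrt (μ ^ 2 - 4 * (a - b) ^ 2) := by
          field_simp
    · rw [if_neg hout]
      positivity

/-- **(B2) — logarithmic van Hove bound.** For `a, b > 0`, `|μ| < 2(a+b)` (inside the band),
`|μ| ≠ 2|a-b|`, and any `C ≥ 16ab`, `C ≥ P = 4(a+b)² - μ²`:
`anisoDOSMass μ a b ≤ 2·(2 log(1+√2) + ½ log(C/x))/√(ab)`, `x = |4(a-b)² - μ²|`, i.e.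
`ρ(μ; a, b) ≤ (c_K + ½ log(C/x))/(2π²√(ab))`, `c_K = 2 log(1+√2)` (from
`K(m) ≤ log(1/√(1-m)) + c_K`, `1 - m = x/P` resp. `x/(16ab)`, and `√P ≥ 4√(ab)` inside the van Hove
energy). [cite: RaghuKivelsonScalapino2010, §II (6)] -/
theorem anisoDOSMass_le_log (ha : 0 < a) (hb : 0 < b) (hμ : |μ| ≠ 2 * |a - b|)
    (hμ' : |μ| < 2 * (a + b)) {C : ℝ} (hC₁ : 16 * a * b ≤ C) (hC₂ : 4 * (a + b) ^ 2 - μ ^ 2 ≤ C) :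
    anisoDOSMass μ a b ≤
      2 * (2 * Real.log (1 + Real.sqrt 2) + Real.log (C / |4 * (a - b) ^ 2 - μ ^ 2|) / 2)
        / Real.sqrt (a * b) := by
  have hab : 0 < 16 * a * b := by positivity
  have hC : 0 < C := lt_of_lt_of_le hab hC₁
  have hsab : 0 < Real.sqrt (a * b) := Real.sqrt_pos.2 (by positivity)
  have hsabne := hsab.ne'
  have hP : 0 < 4 * (a + b) ^ 2 - μ ^ 2 := by
    have h2 : |μ| < |2 * (a + b)| := by rwa [abs_of_pos (by positivity : (0:ℝ) < 2 * (a + b))]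
    have := sq_lt_sq.2 h2
    nlinarith
  unfold anisoDOSMass
  by_cases hin : |μ| < 2 * |a - b|
  · -- inside the van Hove energy
    rw [if_pos hin]
    have hx : 0 < 4 * (a - b) ^ 2 - μ ^ 2 := by linarith [sq_lt_four_mul_sq hin]
    rw [abs_of_pos hx]
    have hm0 : 0 ≤ 16 * a * b / (4 * (a + b) ^ 2 - μ ^ 2) := div_nonneg hab.le hP.le
    have hm1 : 16 * a * b / (4 * (a + b) ^ 2 - μ ^ 2) < 1 := (div_lt_one hP).2 (by nlinarith)
    have h1m : 1 - 16 * a * b / (4 * (a + b) ^ 2 - μ ^ 2)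
        = (4 * (a - b) ^ 2 - μ ^ 2) / (4 * (a + b) ^ 2 - μ ^ 2) := by
      field_simp
      linarith
    have hK := ellipticK_le_log hm0 hm1
    have hlog : Real.log (1 / Real.sqrt (1 - 16 * a * b / (4 * (a + b) ^ 2 - μ ^ 2)))
        ≤ Real.log (C / (4 * (a - b) ^ 2 - μ ^ 2)) / 2 := by
      rw [h1m, one_div, Real.log_inv, Real.log_sqrt (div_nonneg hx.le hP.le),
        Real.log_div hx.ne' hP.ne', Real.log_div hC.ne' hx.ne']
      have := Real.log_le_log hP hC₂
      linarith
    have hsP : 4 * Real.sqrt (a * b) ≤ Real.sqrt (4 * (a + b) ^ 2 - μ ^ 2) := by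
      rw [← sqrt_sixteen_mul]
      exact Real.sqrt_le_sqrt (by nlinarith)
    have hKnn := ellipticK_nonneg (16 * a * b / (4 * (a + b) ^ 2 - μ ^ 2))
    calc 8 * ellipticK (16 * a * b / (4 * (a + b) ^ 2 - μ ^ 2)) / Real.sqrt (4 * (a + b) ^ 2 - μ ^ 2)
        ≤ 8 * ellipticK (16 * a * b / (4 * (a + b) ^ 2 - μ ^ 2)) / (4 * Real.sqrt (a * b)) :=
          div_le_div_of_nonneg_left (by positivity) (by positivity) hsP
      _ = 2 * ellipticK (16 * a * b / (4 * (a + b) ^ 2 - μ ^ 2)) / Real.sqrt (a * b) := by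
          field_simp
          ring
      _ ≤ 2 * (2 * Real.log (1 + Real.sqrt 2) + Real.log (C / (4 * (a - b) ^ 2 - μ ^ 2)) / 2)
            / Real.sqrt (a * b) := by
          gcongr
          linarith
  · -- between the van Hove energy and the band edge
    rw [if_neg hin, if_pos hμ']
    have hgt : 2 * |a - b| < |μ| := lt_of_le_of_ne (not_lt.1 hin) (Ne.symm hμ)
    have hx : 0 < μ ^ 2 - 4 * (a - b) ^ 2 := by linarith [four_mul_sq_lt_sq hgt]
    rw [abs_of_neg (by linarith : 4 * (a - b) ^ 2 - μ ^ 2 < 0), neg_sub]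
    have hm0 : 0 ≤ (4 * (a + b) ^ 2 - μ ^ 2) / (16 * a * b) := div_nonneg hP.le hab.le
    have hm1 : (4 * (a + b) ^ 2 - μ ^ 2) / (16 * a * b) < 1 := (div_lt_one hab).2 (by nlinarith)
    have h1m : 1 - (4 * (a + b) ^ 2 - μ ^ 2) / (16 * a * b) = (μ ^ 2 - 4 * (a - b) ^ 2) / (16 * a * b) := by
      field_simp
      ring
    have hK := ellipticK_le_log hm0 hm1
    have hlog : Real.log (1 / Real.sqrt (1 - (4 * (a + b) ^ 2 - μ ^ 2) / (16 * a * b)))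
        ≤ Real.log (C / (μ ^ 2 - 4 * (a - b) ^ 2)) / 2 := by
      rw [h1m, one_div, Real.log_inv, Real.log_sqrt (div_nonneg hx.le hab.le),
        Real.log_div hx.ne' hab.ne', Real.log_div hC.ne' hx.ne']
      have := Real.log_le_log hab hC₁
      linarith
    calc 2 * ellipticK ((4 * (a + b) ^ 2 - μ ^ 2) / (16 * a * b)) / Real.sqrt (a * b)
        ≤ 2 * (2 * Real.log (1 + Real.sqrt 2) + Real.log (C / (μ ^ 2 - 4 * (a - b) ^ 2)) / 2)
            / Real.sqrt (a * b) := by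
          gcongr
          linarith

end Literature.MathematicalPhysics.QuantumLattice

end
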